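import Summits.BirchSwinnertonDyer.BirchSwinnertonDyer.Theorems.ResidualThetaTransportAtTwoResidualSignedLambdaLowerCMAtTwoRhoLayerPairingProjection
import Literature.NumberTheory.EllipticCurves.GreenbergSelmerCofreeReductionSeparated
import Literature.NumberTheory.EllipticCurves.Kato2004.IwasawaTwistTateLimitClassProofs
import Literature.NumberTheory.EllipticCurves.IwasawaTwistModPShapiroCores
import HarnessLib

/-!
# Kőnig bookkeeping of the deep half of RSL_g: levelwise solution sets in `H¹(ℚ_n, A_ρ[p^k])` ⇒ ONE cores-compatible family in
# `H¹(ℚ_n, T_ρ)` ⇒ ONE element of Kato's `𝐇¹_Γ(T_ρ)` (card k3-g10 H-A + H-B, with SEP_ρ and UN_ρ discharged)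

Route `ResidualThetaTransportAtTwo`, crux RSL_g `ResidualSignedLambdaLowerCMAtTwo` (stmt-BirchSwinnertonDyer-22608); width prover of the cell
`bsd-wall` (`--supports 22608 --as helper`, closes nothing). THEOREMS ONLY (no definition, no named fact, no instance, no `sorry`). Stub plan
rev 14 item Q59 = card `Ideas/stub-cmlambdalower-k3-g10.md` (`Sketch_sidea_k3_g10.lean`, credit sidea k3 g10): the interior step shared by
items 6/7 of `Lines/onepair.lean` (Q46″ slot (c)). §A coefficient-free: `exists_compatible₂_of_finite_nonempty` (Kőnig over `ℕ × ℕ`),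
`exists_limitFamily_of_levelwise` (+ LIMIT/SEPARATEDNESS operators), `exists_pinned_of_levelwise`. §B `ρ`-lemmas over landed names:
`cofreeTorsionPow_surjective`, `eq_zero_of_forall_divPowCofreeMk_eq_zero`, `cohomologyMap_cofreeTorsionPow_layerCores` (`[p]_* ∘ Cor = Cor ∘ [p]_*`).
§C the `ρ`-glue with the card's `def … : Prop` signatures INLINED as hypotheses: `exists_layerFamily_of_levelwise` (LIM_ρ, SEP_ρ hypotheses),
`exists_layerFamily_of_levelwise_of_compactSpace` (SEP_ρ discharged: `GreenbergSelmer.eq_of_forall_reduceH1CofreePkTorsion_eq`),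
`exists_iwasawaH1_of_levelwise` (κ cyclotomic: UN_ρ = `UniversalNorms.mem_integralH1_of_layerCores_eq_framed` + `IwasawaH1DataCoeff.proj_surjective`
⇒ `x : I.H` with `red_{p^k}(I.proj n x) ∈ Sol n k`; only LIM_ρ = card item H-C remains a hypothesis). BSD is not proved by any of this.

References: [Rubin2000] App. B Prop. B.2.3, §B.3; [Kato2004Asterisque] §8.2, §12.2 (p. 220), §13.8 (p. 228), Lemma 8.5 (2) (p. 183);
[NeukirchSchmidtWingberg2008] I §5; [Greenberg1989] §1 p. 98.
-/

set_option autoImplicit false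
-- the Theorems namespace of this sub repeats the summit name by design (D-0017 nested layout)
set_option linter.dupNamespace false

noncomputable section

open scoped Classical

namespace Summit.BirchSwinnertonDyer.BirchSwinnertonDyer.Theorems.CofreeLevelwiseKonig

open CategoryTheory Field NumberField IsDedekindDomain
  Literature.NumberTheory.EllipticCurves Literature.NumberTheory.GaloisRepresentations
  Literature.NumberTheory.EllipticCurves.GreenbergSelmer Literature.NumberTheory.EllipticCurves.CyclotomicLayer
  Literature.NumberTheory.EllipticCurves.Kato2004
  Literature.NumberTheory.GaloisCohomology ZpExtension
  Summit.BirchSwinnertonDyer.BirchSwinnertonDyer.Theorems.ThetaTransport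

universe u w

/-! ## §A Abstract glue: Kőnig over `ℕ × ℕ`, the limit family, the pinned form -/

section Abstract

/-- **Kőnig's lemma for a double tower** (coefficient-free form of `Kato2004.exists_compatible_of_finite_nonempty`): `X n k` any types with a
zero, `red n k : X n (k+1) → X n k`, `cor n k : X (n+1) k → X n k` commuting, `S n k ⊆ X n k` finite, stable, with `S j j` non-empty ⇒ a doubly
compatible family inside the `S n k` (Kőnig on the truncations to the squares `[0, j]²`). Credit: card k3-g10 (sidea), kernel-checked there.
[cite: Rubin2000, App. B §B.3 (p. 228)] [cite: Kato2004Asterisque, §12.2 (p. 220)] -/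
theorem exists_compatible₂_of_finite_nonempty {X : ℕ → ℕ → Type u} [∀ n k, Zero (X n k)]
    (red : ∀ n k, X n (k + 1) → X n k) (cor : ∀ n k, X (n + 1) k → X n k)
    (hcomm : ∀ n k (x : X (n + 1) (k + 1)), red n k (cor n (k + 1) x) = cor n k (red (n + 1) k x))
    (S : ∀ n k, Set (X n k)) (hfin : ∀ n k, (S n k).Finite) (hne : ∀ j, (S j j).Nonempty)
    (hSk : ∀ n k, ∀ x ∈ S n (k + 1), red n k x ∈ S n k) (hSn : ∀ n k, ∀ x ∈ S (n + 1) k, cor n k x ∈ S n k) :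
    ∃ c : ∀ n k, X n k, (∀ n k, c n k ∈ S n k) ∧ (∀ n k, red n k (c n (k + 1)) = c n k) ∧
      (∀ n k, cor n k (c (n + 1) k) = c n k) := by
  classical
  -- truncated compatible families on the square `[0, j]²` (zero outside the square)
  let P : ℕ → (∀ n k : ℕ, X n k) → Prop := fun j c ↦
    (∀ n k, n ≤ j → k ≤ j → c n k ∈ S n k) ∧
    (∀ n k, n + 1 ≤ j → k ≤ j → cor n k (c (n + 1) k) = c n k) ∧
    (∀ n k, n ≤ j → k + 1 ≤ j → red n k (c n (k + 1)) = c n k) ∧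
    (∀ n k, ¬ (n ≤ j ∧ k ≤ j) → c n k = 0)
  let Y : ℕ → Type u := fun j ↦ {c // P j c}
  -- non-emptiness: push an element of `S j j` down the square
  have hY : ∀ j, Nonempty (Y j) := by
    intro j
    obtain ⟨s, hs⟩ := hne j
    let r : ∀ k, k ≤ j → X j k := fun k hk ↦
      Nat.decreasingInduction (motive := fun k _ ↦ X j k) (fun k _ x ↦ red j k x) s hk
    have hr_self : r j le_rfl = s := Nat.decreasingInduction_self _ _
    have hr_succ : ∀ k (hk : k + 1 ≤ j), r k (Nat.le_of_succ_le hk) = red j k (r (k + 1) hk) :=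
      fun k hk ↦ Nat.decreasingInduction_succ_left _ _ hk _
    have hr_mem : ∀ d k (hk : k ≤ j), k + d = j → r k hk ∈ S j k := by
      intro d
      induction d with
      | zero =>
          intro k hk hkj
          obtain rfl : j = k := by omega
          rw [hr_self]
          exact hs
      | succ d ih =>
          intro k hk hkj
          have hk1 : k + 1 ≤ j := by omega
          rw [hr_succ k hk1]
          exact hSk j k _ (ih (k + 1) hk1 (by omega))
    let cc : ∀ k, k ≤ j → ∀ n, n ≤ j → X n k := fun k hk n hn ↦
      Nat.decreasingInduction (motive := fun n _ ↦ X n k) (fun n _ x ↦ cor n k x) (r k hk) hn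
    have hcc_self : ∀ k (hk : k ≤ j), cc k hk j le_rfl = r k hk := fun k hk ↦ Nat.decreasingInduction_self _ _
    have hcc_succ : ∀ k (hk : k ≤ j) n (hn : n + 1 ≤ j),
        cc k hk n (Nat.le_of_succ_le hn) = cor n k (cc k hk (n + 1) hn) :=
      fun k hk n hn ↦ Nat.decreasingInduction_succ_left _ _ hn _
    have hcc_mem : ∀ k (hk : k ≤ j) d n (hn : n ≤ j), n + d = j → cc k hk n hn ∈ S n k := by
      intro k hk d
      induction d with
      | zero =>
          intro n hn hnj
          obtain rfl : j = n := by omega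
          rw [hcc_self]
          exact hr_mem (j - k) k hk (by omega)
      | succ d ih =>
          intro n hn hnj
          have hn1 : n + 1 ≤ j := by omega
          rw [hcc_succ k hk n hn1]
          exact hSn n k _ (ih (n + 1) hn1 (by omega))
    have hcc_red : ∀ k (hk : k + 1 ≤ j) d n (hn : n ≤ j), n + d = j →
        red n k (cc (k + 1) hk n hn) = cc k (Nat.le_of_succ_le hk) n hn := by
      intro k hk d
      induction d with
      | zero =>
          intro n hn hnj
          obtain rfl : j = n := by omega
          rw [hcc_self, hcc_self]
          exact (hr_succ k hk).symm
      | succ d ih =>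
          intro n hn hnj
          have hn1 : n + 1 ≤ j := by omega
          rw [hcc_succ (k + 1) hk n hn1, hcc_succ k (Nat.le_of_succ_le hk) n hn1, hcomm, ih (n + 1) hn1 (by omega)]
    let c₀ : ∀ n k : ℕ, X n k := fun n k ↦ if h : n ≤ j ∧ k ≤ j then cc k h.2 n h.1 else 0
    refine ⟨⟨c₀, ?_, ?_, ?_, ?_⟩⟩
    · intro n k hn hk
      simp only [c₀, dif_pos (And.intro hn hk)]
      exact hcc_mem k hk (j - n) n hn (by omega)
    · intro n k hn hk
      simp only [c₀, dif_pos (And.intro hn hk), dif_pos (And.intro (Nat.le_of_succ_le hn) hk)]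
      exact (hcc_succ k hk n hn).symm
    · intro n k hn hk
      simp only [c₀, dif_pos (And.intro hn hk), dif_pos (And.intro hn (Nat.le_of_succ_le hk))]
      exact hcc_red k hk (j - n) n hn (by omega)
    · intro n k h
      simp only [c₀, dif_neg h]
  -- the restriction maps `[0, j+1]² → [0, j]²`
  let trunc : ℕ → (∀ n k : ℕ, X n k) → (∀ n k : ℕ, X n k) := fun j c n k ↦ if n ≤ j ∧ k ≤ j then c n k else 0
  have htruncP : ∀ (j : ℕ) (c : Y (j + 1)), P j (trunc j c.1) := by
    intro j c
    obtain ⟨h1, h2, h3, h4⟩ := c.2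
    refine ⟨?_, ?_, ?_, ?_⟩
    · intro n k hn hk
      simp only [trunc, if_pos (And.intro hn hk)]
      exact h1 n k (by omega) (by omega)
    · intro n k hn hk
      simp only [trunc, if_pos (And.intro hn hk), if_pos (And.intro (Nat.le_of_succ_le hn) hk)]
      exact h2 n k (by omega) (by omega)
    · intro n k hn hk
      simp only [trunc, if_pos (And.intro hn hk), if_pos (And.intro hn (Nat.le_of_succ_le hk))]
      exact h3 n k (by omega) (by omega)
    · intro n k h
      simp only [trunc, if_neg h]
  let f₀ : ∀ j, Y (j + 1) → Y j := fun j c ↦ ⟨trunc j c.1, htruncP j c⟩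
  let f : ∀ j, Y (j + 1) ⟶ Y j := fun j ↦ TypeCat.ofHom (f₀ j)
  let F : ℕᵒᵖ ⥤ Type u := Functor.ofOpSequence (X := Y) f
  haveI : ∀ j : ℕᵒᵖ, Finite (F.obj j) := fun j ↦ by
    change Finite (Y j.unop)
    haveI : ∀ n k, Finite (S n k) := fun n k ↦ (hfin n k).to_subtype
    let ι : Y j.unop → (∀ a b : Fin (j.unop + 1), S a b) := fun c a b ↦
      ⟨c.1 a b, c.2.1 a b (Nat.le_of_lt_succ a.2) (Nat.le_of_lt_succ b.2)⟩
    refine Finite.of_injective ι fun c c' h ↦ Subtype.ext (funext fun n ↦ funext fun k ↦ ?_)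
    by_cases hnk : n ≤ j.unop ∧ k ≤ j.unop
    · have h' := congrArg
        (fun g : (∀ a b : Fin (j.unop + 1), S a b) ↦
          ((g ⟨n, Nat.lt_succ_of_le hnk.1⟩ ⟨k, Nat.lt_succ_of_le hnk.2⟩ : S n k) : X n k)) h
      exact h'
    · rw [c.2.2.2.2 n k hnk, c'.2.2.2.2 n k hnk]
  haveI : ∀ j : ℕᵒᵖ, Nonempty (F.obj j) := fun j ↦ hY j.unop
  -- Kőnig
  obtain ⟨u, hu⟩ := nonempty_sections_of_finite_inverse_system F
  have hstep : ∀ j n k, n ≤ j → k ≤ j →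
      ((u (Opposite.op (j + 1)) : Y (j + 1)).1 n k = (u (Opposite.op j) : Y j).1 n k) := by
    intro j n k hn hk
    have h := hu (homOfLE (Nat.le_add_right j 1)).op
    rw [Functor.ofOpSequence_map_homOfLE_succ] at h
    have h' : (if n ≤ j ∧ k ≤ j then (u (Opposite.op (j + 1)) : Y (j + 1)).1 n k else 0) =
        (u (Opposite.op j) : Y j).1 n k :=
      congrArg (fun c : Y j ↦ c.1 n k) h
    rwa [if_pos (And.intro hn hk)] at h'
  have hstable : ∀ j j', j ≤ j' → ∀ n k, n ≤ j → k ≤ j →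
      ((u (Opposite.op j') : Y j').1 n k = (u (Opposite.op j) : Y j).1 n k) := by
    intro j j' hjj'
    induction j', hjj' using Nat.le_induction with
    | base => intro n k _ _; rfl
    | succ j' hjj' ih =>
        intro n k hn hk
        rw [hstep j' n k (hn.trans hjj') (hk.trans hjj'), ih n k hn hk]
  refine ⟨fun n k ↦ (u (Opposite.op (n + k)) : Y (n + k)).1 n k, fun n k ↦ ?_, fun n k ↦ ?_, fun n k ↦ ?_⟩
  · exact (u (Opposite.op (n + k)) : Y (n + k)).2.1 n k (Nat.le_add_right n k) (Nat.le_add_left k n)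
  · rw [(u (Opposite.op (n + (k + 1))) : Y (n + (k + 1))).2.2.2.1 n k (Nat.le_add_right n (k + 1))
      (Nat.le_add_left (k + 1) n)]
    exact hstable (n + k) (n + (k + 1)) (by omega) n k (Nat.le_add_right n k) (Nat.le_add_left k n)
  · rw [(u (Opposite.op (n + 1 + k)) : Y (n + 1 + k)).2.2.1 n k (Nat.le_add_right (n + 1) k)
      (Nat.le_add_left k (n + 1))]
    exact hstable (n + k) (n + 1 + k) (by omega) n k (Nat.le_add_right n k) (Nat.le_add_left k n)

/-- **The limit family from levelwise solutions** (coefficient-free form of `Kato2004.exists_normCompatible_of_compatible`): add limit objects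
`Y n` with reductions `π n k` and a trace `Cor`, a per-layer LIMIT OPERATOR (Rubin B.2.3 surjectivity) and SEPARATEDNESS (B.2.3 injectivity);
then a `Cor`-compatible family with all reductions in the solution sets exists. Credit: card k3-g10.
[cite: Rubin2000, App. B Prop. B.2.3 and §B.3] [cite: Kato2004Asterisque, §8.2 (p. 181), §12.2 (p. 220)] -/
theorem exists_limitFamily_of_levelwise {X : ℕ → ℕ → Type u} [∀ n k, Zero (X n k)] {Y : ℕ → Type w}
    (red : ∀ n k, X n (k + 1) → X n k) (cor : ∀ n k, X (n + 1) k → X n k)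
    (hcomm : ∀ n k (x : X (n + 1) (k + 1)), red n k (cor n (k + 1) x) = cor n k (red (n + 1) k x))
    (S : ∀ n k, Set (X n k)) (hfin : ∀ n k, (S n k).Finite) (hne : ∀ j, (S j j).Nonempty)
    (hSk : ∀ n k, ∀ x ∈ S n (k + 1), red n k x ∈ S n k) (hSn : ∀ n k, ∀ x ∈ S (n + 1) k, cor n k x ∈ S n k)
    (π : ∀ n k, Y n → X n k) (Cor : ∀ n, Y (n + 1) → Y n)
    (hπCor : ∀ n k (y : Y (n + 1)), π n k (Cor n y) = cor n k (π (n + 1) k y))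
    (lim : ∀ n (c : ∀ k, X n k), (∀ k, red n k (c (k + 1)) = c k) → ∃ y : Y n, ∀ k, π n k y = c k)
    (sep : ∀ n (y y' : Y n), (∀ k, π n k y = π n k y') → y = y') :
    ∃ y : ∀ n, Y n, (∀ n k, π n k (y n) ∈ S n k) ∧ ∀ n, Cor n (y (n + 1)) = y n := by
  obtain ⟨c, hcS, hck, hcn⟩ := exists_compatible₂_of_finite_nonempty red cor hcomm S hfin hne hSk hSn
  choose y hy using fun n ↦ lim n (c n) (hck n)
  refine ⟨y, fun n k ↦ (hy n k).symm ▸ hcS n k, fun n ↦ sep n _ _ fun k ↦ ?_⟩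
  rw [hπCor, hy, hy, hcn]

/-- **The pinned form** (abstract `IwasawaH1DataCoeff.proj_surjective` step): if `Int` follows from "reductions in the solution sets and
`Cor`-compatible" and `proj : H → ∀ n, Y n` hits every `Int` family, the limit family is `proj x`. Credit: card k3-g10. [cite: Kato2004Asterisque, §12.2 (p. 220)] -/
theorem exists_pinned_of_levelwise {X : ℕ → ℕ → Type u} [∀ n k, Zero (X n k)] {Y : ℕ → Type w} {H : Type*}
    (red : ∀ n k, X n (k + 1) → X n k) (cor : ∀ n k, X (n + 1) k → X n k)
    (hcomm : ∀ n k (x : X (n + 1) (k + 1)), red n k (cor n (k + 1) x) = cor n k (red (n + 1) k x))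
    (S : ∀ n k, Set (X n k)) (hfin : ∀ n k, (S n k).Finite) (hne : ∀ j, (S j j).Nonempty)
    (hSk : ∀ n k, ∀ x ∈ S n (k + 1), red n k x ∈ S n k) (hSn : ∀ n k, ∀ x ∈ S (n + 1) k, cor n k x ∈ S n k)
    (π : ∀ n k, Y n → X n k) (Cor : ∀ n, Y (n + 1) → Y n)
    (hπCor : ∀ n k (y : Y (n + 1)), π n k (Cor n y) = cor n k (π (n + 1) k y))
    (lim : ∀ n (c : ∀ k, X n k), (∀ k, red n k (c (k + 1)) = c k) → ∃ y : Y n, ∀ k, π n k y = c k)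
    (sep : ∀ n (y y' : Y n), (∀ k, π n k y = π n k y') → y = y')
    (Int : (∀ n, Y n) → Prop)
    (hInt : ∀ y : ∀ n, Y n, (∀ n k, π n k (y n) ∈ S n k) → (∀ n, Cor n (y (n + 1)) = y n) → Int y)
    (proj : H → ∀ n, Y n) (hproj : ∀ y, Int y → ∃ x, proj x = y) :
    ∃ x : H, ∀ n k, π n k (proj x n) ∈ S n k := by
  obtain ⟨y, hyS, hyC⟩ := exists_limitFamily_of_levelwise red cor hcomm S hfin hne hSk hSn π Cor hπCor lim sep
  obtain ⟨x, rfl⟩ := hproj y (hInt y hyS hyC)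
  exact ⟨x, hyS⟩

end Abstract

/-! ## §B Small `ρ`-lemmas over landed declarations -/

section RhoLemmas

variable {p : ℕ} [Fact p.Prime] (S : Set (PadicAlgCl p)) {d : ℕ} (ρ : FramedGaloisRep ℚ ↥(padicCoeffIntegers S) d) (k : ℕ)

/-- **`[p] : A_ρ[p^{k+1}] → A_ρ[p^k]` is onto** (the `tr_surjective` axiom of the coefficient tower; `ρ`-twin of
`Kato2004.geomTorsionReduce_surjective`, with `divPowCofreeMkTorsion_surjective` + `cofreeTorsionPow_divPowCofreeMkTorsion` replacing the
divisibility of `E(ℚ̄)`). Credit: card k3-g10. [cite: Greenberg1989, §1 p. 98] [cite: Kato2004Asterisque, §13.8 (p. 228)] -/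
theorem cofreeTorsionPow_surjective : Function.Surjective (cofreeTorsionPow S ρ k).hom := by
  intro a
  obtain ⟨t, ht⟩ := divPowCofreeMkTorsion_surjective S ρ k a
  exact ⟨divPowCofreeMkTorsion S ρ (k + 1) t, by rw [cofreeTorsionPow_divPowCofreeMkTorsion, ht]⟩

/-- **Adic separatedness of `T_ρ = 𝒪ⁿ` along `divPowCofreeMk`**: `t ∈ T_ρ` with `p^{-k} t ≡ 0 mod 𝒪ⁿ` for all `k` is `0` (`⋂_k p^k 𝒪 = 0`:
`‖p^k s‖ ≤ p^{-k} → 0` in `ℚ̄_p`; no finiteness of `[ℚ_p(S) : ℚ_p]` needed). The `proj_injective` axiom of the `Cofree` tower presentation of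
`T_ρ`. Credit: card k3-g10. [cite: Greenberg1989, §1 p. 98] [cite: NeukirchANT1999, Ch. II (4.8)] -/
theorem eq_zero_of_forall_divPowCofreeMk_eq_zero (t : Fin d → ↥(padicCoeffIntegers S))
    (h : ∀ k, divPowCofreeMk S ρ k t = 0) : t = 0 := by
  funext i
  have hmem : ∀ k, t i ∈ Ideal.span {((p : padicCoeffIntegers S)) ^ k} := fun k ↦ (divPowCofreeMk_eq_zero_iff S ρ k t).mp (h k) i
  have hp1 : ‖(p : PadicAlgCl p)‖ < 1 := by
    rw [← map_natCast (algebraMap ℚ_[p] (PadicAlgCl p)), PadicAlgCl.norm_extends, Padic.norm_p]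
    exact inv_lt_one_of_one_lt₀ (by exact_mod_cast (Fact.out : p.Prime).one_lt)
  have hle : ∀ k, ‖((t i : padicCoeffIntegers S) : PadicAlgCl p)‖ ≤ ‖(p : PadicAlgCl p)‖ ^ k := by
    intro k
    obtain ⟨s, hs⟩ := Ideal.mem_span_singleton'.mp (hmem k)
    have hti : ((t i : padicCoeffIntegers S) : PadicAlgCl p) = (s : PadicAlgCl p) * (p : PadicAlgCl p) ^ k := by
      rw [← hs]
      push_cast
      rfl
    rw [hti, norm_mul, norm_pow]
    calc ‖(s : PadicAlgCl p)‖ * ‖(p : PadicAlgCl p)‖ ^ k ≤ 1 * ‖(p : PadicAlgCl p)‖ ^ k :=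
          mul_le_mul_of_nonneg_right s.2.2 (pow_nonneg (norm_nonneg _) _)
      _ = ‖(p : PadicAlgCl p)‖ ^ k := one_mul _
  have h0 : ‖((t i : padicCoeffIntegers S) : PadicAlgCl p)‖ ≤ 0 :=
    ge_of_tendsto (tendsto_pow_atTop_nhds_zero_of_lt_one (norm_nonneg _) hp1) (Filter.Eventually.of_forall hle)
  have hz : ((t i : padicCoeffIntegers S) : PadicAlgCl p) = 0 := norm_le_zero_iff.mp h0
  exact Subtype.ext (by simpa using hz)

/-- Restricting `g|_{H'}` (`subgroupRepMap`) further to `H ≤ H'` gives `g|_H` (cf. the tree's `restrictHomOfLe_subgroupRepHom`).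
[cite: SerreGaloisCohomology1997, I §2.4] -/
theorem restrictHomOfLe_subgroupRepMap {k' : Type*} [CommRing k'] [TopologicalSpace k'] {G : Type} [Group G] [TopologicalSpace G]
    [IsTopologicalGroup G] {X Y : TopRep.{0} k' G} (g : X ⟶ Y) {H H' : Subgroup G} (h : H ≤ H') :
    restrictHomOfLe h (subgroupRepMap g H') = subgroupRepMap g H := rfl

/-- **`[p]_* ∘ Cor = Cor ∘ [p]_*` with `A_ρ[p^•]`-coefficients** (the `hcomm` square of §A for `ρ`): an instance of the generic
`cohomologyMap_coresLe` ("Cor is a morphism of cohomological functors"), via `TwistTate.layerCores_eq_coresLe`. Credit: card k3-g10.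
[cite: SerreGaloisCohomology1997, I §2.4] [cite: NeukirchSchmidtWingberg2008, I §5] -/
theorem cohomologyMap_cofreeTorsionPow_layerCores (κ : ZpExtension ℚ p) (n : ℕ)
    (x : H1 (cofreeTorsionGaloisModule S ρ ((p ^ (k + 1) : ℕ) : ℤ)) (κ.layerSubgroup (n + 1))) :
    cohomologyMap (subgroupRepMap (cofreeTorsionPow S ρ k) (κ.layerSubgroup n)) 1
        (layerCores (cofreeTorsionGaloisModule S ρ ((p ^ (k + 1) : ℕ) : ℤ)) κ n x) =
      layerCores (cofreeTorsionGaloisModule S ρ ((p ^ k : ℕ) : ℤ)) κ n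
        (cohomologyMap (subgroupRepMap (cofreeTorsionPow S ρ k) (κ.layerSubgroup (n + 1))) 1 x) := by
  haveI : CompactSpace (absoluteGaloisGroup ℚ) := absoluteGaloisGroup_compactSpace ℚ
  haveI : (κ.layerSubgroup (n + 1)).FiniteIndex :=
    finiteIndex_of_isOpen_of_compactSpace _ (κ.isOpen_layerSubgroup (n + 1))
  letI : Fintype (↥(κ.layerSubgroup n) ⧸ (κ.layerSubgroup (n + 1)).subgroupOf (κ.layerSubgroup n)) := Fintype.ofFinite _
  rw [TwistTate.layerCores_eq_coresLe (κ := κ) (n := n) (c := x), TwistTate.layerCores_eq_coresLe (κ := κ) (n := n),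
    cohomologyMap_coresLe (κ.layerSubgroup_antitone (Nat.le_succ n)) (κ.isOpen_layerSubgroup (n + 1))
      (subgroupRepMap (cofreeTorsionPow S ρ k) (κ.layerSubgroup n)) x,
    restrictHomOfLe_subgroupRepMap]

end RhoLemmas

/-! ## §C The `ρ`-glue: levelwise solution sets ⇒ one cores-compatible family ⇒ one element of `𝐇¹_Γ(T_ρ)` -/

section RhoGlue

variable {p : ℕ} [Fact p.Prime] (S : Set (PadicAlgCl p)) {d : ℕ} (ρ : FramedGaloisRep ℚ ↥(padicCoeffIntegers S) d)
  (κ : ZpExtension ℚ p)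

/-- **From levelwise solution sets to ONE cores-compatible family `y n ∈ H¹(ℚ_n, T_ρ)`** (card k3-g10 H-B, hypotheses inline): finite,
diagonally non-empty, `[p]_*`/`Cor`-stable `Sol n k ⊆ H¹(ℚ_n, A_ρ[p^k])` + LIM_ρ (Rubin B.2.3 surjectivity for `T_ρ`) + SEP_ρ (injectivity) at
every layer ⇒ a `Cor`-compatible `y` with `red_{p^k} y_n ∈ Sol n k` (§A at `X n k := H¹(ℚ_n, A_ρ[p^k])`, `Y n := H¹(ℚ_n, T_ρ)`, `π := red`,
`Cor := layerCores`). [cite: Kato2004Asterisque, §12.2 (p. 220), §13.8 (p. 228)] [cite: Rubin2000, App. B Prop. B.2.3 and §B.3] -/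
theorem exists_layerFamily_of_levelwise
    (Sol : ∀ n k : ℕ, Set (H1 (cofreeTorsionGaloisModule S ρ ((p ^ k : ℕ) : ℤ)) (κ.layerSubgroup n)))
    (hfin : ∀ n k, (Sol n k).Finite) (hne : ∀ j, (Sol j j).Nonempty)
    (hSk : ∀ n k, ∀ c ∈ Sol n (k + 1), cohomologyMap (subgroupRepMap (cofreeTorsionPow S ρ k) (κ.layerSubgroup n)) 1 c ∈ Sol n k)
    (hSn : ∀ n k, ∀ c ∈ Sol (n + 1) k, layerCores (cofreeTorsionGaloisModule S ρ ((p ^ k : ℕ) : ℤ)) κ n c ∈ Sol n k)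
    (hlim : ∀ (n : ℕ) (c : ∀ k : ℕ, H1 (cofreeTorsionGaloisModule S ρ ((p ^ k : ℕ) : ℤ)) (κ.layerSubgroup n)),
      (∀ k, cohomologyMap (subgroupRepMap (cofreeTorsionPow S ρ k) (κ.layerSubgroup n)) 1 (c (k + 1)) = c k) →
        ∃ x : H1 (FramedGaloisRep.toGaloisRep ρ) (κ.layerSubgroup n), ∀ k,
          (reduceH1CofreePkTorsion S ρ k (κ.layerSubgroup n) x :
            H1 (cofreeTorsionGaloisModule S ρ ((p ^ k : ℕ) : ℤ)) (κ.layerSubgroup n)) = c k)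
    (hsep : ∀ (n : ℕ) (x y : H1 (FramedGaloisRep.toGaloisRep ρ) (κ.layerSubgroup n)),
      (∀ k, reduceH1CofreePkTorsion S ρ k (κ.layerSubgroup n) x = reduceH1CofreePkTorsion S ρ k (κ.layerSubgroup n) y) → x = y) :
    ∃ y : ∀ n : ℕ, H1 (FramedGaloisRep.toGaloisRep ρ) (κ.layerSubgroup n),
      (∀ n k, (reduceH1CofreePkTorsion S ρ k (κ.layerSubgroup n) (y n) :
          H1 (cofreeTorsionGaloisModule S ρ ((p ^ k : ℕ) : ℤ)) (κ.layerSubgroup n)) ∈ Sol n k) ∧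
      ∀ n, layerCores (FramedGaloisRep.toGaloisRep ρ) κ n (y (n + 1)) = y n := by
  obtain ⟨y, hyS, hyC⟩ := exists_limitFamily_of_levelwise
    (X := fun n k ↦ H1 (cofreeTorsionGaloisModule S ρ ((p ^ k : ℕ) : ℤ)) (κ.layerSubgroup n))
    (Y := fun n ↦ H1 (FramedGaloisRep.toGaloisRep ρ) (κ.layerSubgroup n))
    (fun n k c ↦ cohomologyMap (subgroupRepMap (cofreeTorsionPow S ρ k) (κ.layerSubgroup n)) 1 c)
    (fun n k c ↦ layerCores (cofreeTorsionGaloisModule S ρ ((p ^ k : ℕ) : ℤ)) κ n c)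
    (fun n k x ↦ cohomologyMap_cofreeTorsionPow_layerCores S ρ k κ n x)
    Sol hfin hne hSk hSn
    (fun n k y ↦ (reduceH1CofreePkTorsion S ρ k (κ.layerSubgroup n) y :
      H1 (cofreeTorsionGaloisModule S ρ ((p ^ k : ℕ) : ℤ)) (κ.layerSubgroup n)))
    (fun n y ↦ layerCores (FramedGaloisRep.toGaloisRep ρ) κ n y)
    (fun n k y ↦ reduceH1CofreePkTorsion_layerCores S ρ k κ n y)
    (fun n c hc ↦ hlim n c hc) (fun n y y' h ↦ hsep n y y' fun k ↦ h k)
  exact ⟨y, hyS, hyC⟩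

/-- **The same with SEP_ρ DISCHARGED** (`𝒪 = padicCoeffIntegers S` compact, e.g. `ℚ_p(S)/ℚ_p` finite): separatedness of `H¹(ℚ_n, T_ρ)` along the
reductions is `GreenbergSelmer.eq_of_forall_reduceH1CofreePkTorsion_eq` (Rubin B.2.3 injectivity for `T_ρ`); only LIM_ρ remains a hypothesis.
[cite: Rubin2000, App. B Prop. B.2.3 and §B.3] [cite: Kato2004Asterisque, §12.2 (p. 220), §13.8 (p. 228)] -/
theorem exists_layerFamily_of_levelwise_of_compactSpace [CompactSpace ↥(padicCoeffIntegers S)]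
    (Sol : ∀ n k : ℕ, Set (H1 (cofreeTorsionGaloisModule S ρ ((p ^ k : ℕ) : ℤ)) (κ.layerSubgroup n)))
    (hfin : ∀ n k, (Sol n k).Finite) (hne : ∀ j, (Sol j j).Nonempty)
    (hSk : ∀ n k, ∀ c ∈ Sol n (k + 1), cohomologyMap (subgroupRepMap (cofreeTorsionPow S ρ k) (κ.layerSubgroup n)) 1 c ∈ Sol n k)
    (hSn : ∀ n k, ∀ c ∈ Sol (n + 1) k, layerCores (cofreeTorsionGaloisModule S ρ ((p ^ k : ℕ) : ℤ)) κ n c ∈ Sol n k)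
    (hlim : ∀ (n : ℕ) (c : ∀ k : ℕ, H1 (cofreeTorsionGaloisModule S ρ ((p ^ k : ℕ) : ℤ)) (κ.layerSubgroup n)),
      (∀ k, cohomologyMap (subgroupRepMap (cofreeTorsionPow S ρ k) (κ.layerSubgroup n)) 1 (c (k + 1)) = c k) →
        ∃ x : H1 (FramedGaloisRep.toGaloisRep ρ) (κ.layerSubgroup n), ∀ k,
          (reduceH1CofreePkTorsion S ρ k (κ.layerSubgroup n) x :
            H1 (cofreeTorsionGaloisModule S ρ ((p ^ k : ℕ) : ℤ)) (κ.layerSubgroup n)) = c k) :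
    ∃ y : ∀ n : ℕ, H1 (FramedGaloisRep.toGaloisRep ρ) (κ.layerSubgroup n),
      (∀ n k, (reduceH1CofreePkTorsion S ρ k (κ.layerSubgroup n) (y n) :
          H1 (cofreeTorsionGaloisModule S ρ ((p ^ k : ℕ) : ℤ)) (κ.layerSubgroup n)) ∈ Sol n k) ∧
      ∀ n, layerCores (FramedGaloisRep.toGaloisRep ρ) κ n (y (n + 1)) = y n :=
  exists_layerFamily_of_levelwise S ρ κ Sol hfin hne hSk hSn hlim
    fun n x y h ↦ eq_of_forall_reduceH1CofreePkTorsion_eq S ρ (κ.layerSubgroup n) x y h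

/-- **From levelwise solution sets to ONE element of Kato's `𝐇¹_Γ(T_ρ)`** (the slot-(c) output of items 6/7 of `Lines/onepair.lean`): for the
CYCLOTOMIC `ℤ_p`-extension `κ`, `𝒪` compact and a pinned datum `I : IwasawaH1DataCoeff ρ.toGaloisRep p κ γ`, under the hypotheses of
`exists_layerFamily_of_levelwise_of_compactSpace` there is `x : I.H` with `red_{p^k} (I.proj n x) ∈ Sol n k` for all `(n, k)`: the cores-compatible
family is INTEGRAL by Kato's Lemma 8.5 (2) for `T_ρ` (`UniversalNorms.mem_integralH1_of_layerCores_eq_framed`, UN_ρ — slack `1`, no purity)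
and hence in the image of `I.proj` (`IwasawaH1DataCoeff.proj_surjective`). Only LIM_ρ (card k3-g10 H-C) remains a hypothesis.
[cite: Kato2004Asterisque, Lemma 8.5 (2) (p. 183), §12.2 (p. 220), §13.8 (p. 228)] [cite: Rubin2000, App. B Prop. B.2.3, B.3.3] -/
theorem exists_iwasawaH1_of_levelwise [CompactSpace ↥(padicCoeffIntegers S)] (hκ : κ.IsCyclotomic)
    {γ : absoluteGaloisGroup ℚ} (I : IwasawaH1DataCoeff (FramedGaloisRep.toGaloisRep ρ) p κ γ)
    (Sol : ∀ n k : ℕ, Set (H1 (cofreeTorsionGaloisModule S ρ ((p ^ k : ℕ) : ℤ)) (κ.layerSubgroup n)))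
    (hfin : ∀ n k, (Sol n k).Finite) (hne : ∀ j, (Sol j j).Nonempty)
    (hSk : ∀ n k, ∀ c ∈ Sol n (k + 1), cohomologyMap (subgroupRepMap (cofreeTorsionPow S ρ k) (κ.layerSubgroup n)) 1 c ∈ Sol n k)
    (hSn : ∀ n k, ∀ c ∈ Sol (n + 1) k, layerCores (cofreeTorsionGaloisModule S ρ ((p ^ k : ℕ) : ℤ)) κ n c ∈ Sol n k)
    (hlim : ∀ (n : ℕ) (c : ∀ k : ℕ, H1 (cofreeTorsionGaloisModule S ρ ((p ^ k : ℕ) : ℤ)) (κ.layerSubgroup n)),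
      (∀ k, cohomologyMap (subgroupRepMap (cofreeTorsionPow S ρ k) (κ.layerSubgroup n)) 1 (c (k + 1)) = c k) →
        ∃ x : H1 (FramedGaloisRep.toGaloisRep ρ) (κ.layerSubgroup n), ∀ k,
          (reduceH1CofreePkTorsion S ρ k (κ.layerSubgroup n) x :
            H1 (cofreeTorsionGaloisModule S ρ ((p ^ k : ℕ) : ℤ)) (κ.layerSubgroup n)) = c k) :
    ∃ x : I.H, ∀ n k, (reduceH1CofreePkTorsion S ρ k (κ.layerSubgroup n) (I.proj n x) :
        H1 (cofreeTorsionGaloisModule S ρ ((p ^ k : ℕ) : ℤ)) (κ.layerSubgroup n)) ∈ Sol n k := by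
  obtain ⟨y, hyS, hyC⟩ := exists_layerFamily_of_levelwise_of_compactSpace S ρ κ Sol hfin hne hSk hSn hlim
  obtain ⟨x, hx⟩ := I.proj_surjective y
    ⟨fun n ↦ UniversalNorms.mem_integralH1_of_layerCores_eq_framed S ρ κ hκ y hyC n, hyC⟩
  exact ⟨x, fun n k ↦ by rw [hx n]; exact hyS n k⟩

end RhoGlue

end Summit.BirchSwinnertonDyer.BirchSwinnertonDyer.Theorems.CofreeLevelwiseKonig

end
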